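import Literature.Probability.Process.HolderNormTightness
import HarnessLib

/-!
# Moduli of continuity in probability from increment tails ABOVE a resolution scale

Topic `Literature/Probability/Process`; theorems only (no definition, no named fact). Companion
to `HolderNormTightness.lean` (quantitative Kolmogorov–Chentsov; Kemppainen–Smirnov, Ann.
Probab. 45 (2017), Prop. 3.8 (2) / Thm. 3.9: tight Hölder norms from sub-exponential two-point
increment tails at ALL dyadic scales). For LATTICE curves the increment tails of the driving
process are available only above the mesh scale (Condition G2 is verified for annuli larger than
the mesh: Kemppainen–Smirnov §4.1.6, "we can also assume `r > η`"), while below it the driving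
function is controlled through the CURVE: a small increment of a simple generating curve forces a
small increment of its driving function (`RandomPlanarGeometry/LoewnerDrivingModulus.lean`,
`Loewner.IsGeneratedByCurve.abs_driving_sub_driving_le_of_modulus`), so a modulus of the
capacity-parametrised curve at the floor scale — an event of the curve, not of the driving
process — is a floor modulus of the driving function. This file proves the corresponding
two-scale statement, in the shape of condition (ii) of Billingsley's tightness criterion
(Thm. 7.3: "`P[w(X_n, δ) ≥ ε] ≤ η` for `n ≥ n₀`", upgraded to all `n` by
`Process/PathSpaceModulus.lean`):

* `KolmogorovChentsov.edist_le_of_increments_le_of_floor` — **resolution-limited chaining**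
  (deterministic): if the consecutive dyadic increments of `f` at the levels `n₀ < m ≤ M` are
  `≤ r^m` and `f` moves by at most `ϑ` over distances `≤ 2^{-M}` (the floor), then
  `edist (f s) (f t) ≤ 2ϑ + 2 ∑_{n₀ < m ≤ M} r^m` whenever `dist s t < 2^{-(n₀+1)}` (approximate
  `s, t` by level-`M` dyadics, one floor step each, and chain between them: Le Gall's Lemma 2.10
  at finitely many levels); no continuity needed;
* `KolmogorovChentsov.measure_badModulus_le_sum` — the **finite union bound** over the levels
  `n₀ < m ≤ M` (outer measure; the floor hypothesis almost surely);
* `measure_badModulus_le_of_subexp_tails_floor` — with **sub-exponential tails on the scales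
  `[2^{-M}, 1]` only**: `P{∃ s, t ≤ N, |s - t| < 2^{-(n₀+1)}, d(X_s, X_t) > 2ϑ + c_α 2^{-α(n₀+1)}}
  ≤ N 2^{-n₀}` for `n₀ ≥ n₁(α, K, c)`, `c_α = 2 (1 - 2^{-α})⁻¹`;
* `exists_level_of_subexp_tails_floor` — **Billingsley's condition (ii), eventually**: for a
  target oscillation `η > 0` and `ε > 0` ONE level `n₀` such that every process with tails above
  its floor scale `2^{-M}` (`M ≥ n₀ + 2`) and floor modulus `ϑ ≤ η/4` has
  `P{∃ s, t ≤ N, |s - t| < 2^{-(n₀+1)}, η ≤ d(X_s, X_t)} ≤ ε` — uniform over all such processes,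
  in particular over all fine enough meshes of a lattice family, the finitely many coarse meshes
  being handled by `Process.exists_forall_measure_badModulusSet_le_of_eventually`;
  `exists_level_of_subexp_tails_floor'` — the same with the floor modulus holding only off a
  measurable event `B`, at the cost `+ P B` (on the lattice the floor is itself an event).

## References

* A. Kemppainen, S. Smirnov, *Random curves, scaling limits and Loewner evolutions*, Ann. Probab.
  45 (2017) 698–779, §3.3 Prop. 3.8 (2), Thm. 3.9; §4.1.6 (scales above the mesh).
  [KemppainenSmirnov2017]
* J.-F. Le Gall, *Brownian Motion, Martingales, and Stochastic Calculus* (2016), Lemma 2.10.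
  [Legall2016]
* P. Billingsley, *Convergence of Probability Measures*, 2nd ed. (1999), Thm. 7.3.
  [Billingsley1999]
-/

noncomputable section

open MeasureTheory ProbabilityTheory Filter Set
open scoped ENNReal NNReal Topology

namespace Literature.Probability.Process

open KolmogorovChentsov

universe u

variable {E : Type*}

namespace KolmogorovChentsov

/-! ### Resolution-limited chaining -/

section Deterministic

variable [PseudoEMetricSpace E]

/-- **Resolution-limited chaining.** Let `n₀ + 2 ≤ M`. If the increments of `f : ℝ≥0 → E` over
consecutive level-`m` dyadics of `[0, N]` are `≤ r^m` for the levels `n₀ < m ≤ M`, and `f`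
moves by at most `ϑ` between points of `[0, N]` at distance `≤ 2^{-M}` (the floor), then
`edist (f s) (f t) ≤ 2ϑ + 2 ∑_{i < M - n₀} r^{n₀+1+i}` for all `s, t ≤ N` with
`dist s t < 2^{-(n₀+1)}`: replace `s, t` by the level-`M` dyadics below them (one floor step
each; the dyadics are then at distance `< 2^{-n₀}`) and chain between those through the levels
`n₀ < m ≤ M` (`KolmogorovChentsov.chain`). No continuity is assumed.
[cite: Legall2016, Lemma 2.10] -/
theorem edist_le_of_increments_le_of_floor {f : ℝ≥0 → E} {r ϑ : ℝ≥0∞} {N n₀ M : ℕ}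
    (hM : n₀ + 2 ≤ M)
    (h : ∀ m, n₀ < m → m ≤ M → ∀ k, k + 1 ≤ N * 2 ^ m →
      edist (f (dyad m k)) (f (dyad m (k + 1))) ≤ r ^ m)
    (hfloor : ∀ s t : ℝ≥0, s ≤ N → t ≤ N → dist s t ≤ ((2 : ℝ) ^ M)⁻¹ → edist (f s) (f t) ≤ ϑ)
    {s t : ℝ≥0} (hs : s ≤ N) (ht : t ≤ N) (hd : dist s t < ((2 : ℝ) ^ (n₀ + 1))⁻¹) :
    edist (f s) (f t) ≤ 2 * ϑ + 2 * ∑ i ∈ Finset.range (M - n₀), r ^ (n₀ + 1 + i) := by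
  classical
  -- the level-`M` dyadics below `s` and `t`
  set a : ℕ := ⌊(s : ℝ) * 2 ^ M⌋₊ with ha
  set b : ℕ := ⌊(t : ℝ) * 2 ^ M⌋₊ with hb
  have has : dyad M a ≤ s := dyad_floor_le s M
  have hbt : dyad M b ≤ t := dyad_floor_le t M
  have hda : dist (dyad M a) s ≤ ((2 : ℝ) ^ M)⁻¹ := dist_dyad_floor_le s M
  have hdb : dist (dyad M b) t ≤ ((2 : ℝ) ^ M)⁻¹ := dist_dyad_floor_le t M
  have haN : dyad M a ≤ N := has.trans hs
  have hbN : dyad M b ≤ N := hbt.trans ht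
  -- floor steps
  have h1 : edist (f s) (f (dyad M a)) ≤ ϑ := by
    rw [edist_comm]
    exact hfloor _ _ haN hs hda
  have h2 : edist (f (dyad M b)) (f t) ≤ ϑ := hfloor _ _ hbN ht hdb
  -- the two dyadics are at distance `< 2^{-n₀}`
  have hM2 : 2 * ((2 : ℝ) ^ M)⁻¹ ≤ ((2 : ℝ) ^ (n₀ + 1))⁻¹ := by
    have hle : ((2 : ℝ) ^ M)⁻¹ ≤ ((2 : ℝ) ^ (n₀ + 2))⁻¹ := by
      rw [inv_le_inv₀ (by positivity) (by positivity)]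
      exact pow_le_pow_right₀ one_le_two hM
    calc 2 * ((2 : ℝ) ^ M)⁻¹ ≤ 2 * ((2 : ℝ) ^ (n₀ + 2))⁻¹ := by gcongr
      _ = ((2 : ℝ) ^ (n₀ + 1))⁻¹ := by rw [pow_succ, mul_inv]; ring
  have hab : dist (dyad M a) (dyad M b) < ((2 : ℝ) ^ n₀)⁻¹ := by
    have hsucc : ((2 : ℝ) ^ (n₀ + 1))⁻¹ + ((2 : ℝ) ^ (n₀ + 1))⁻¹ = ((2 : ℝ) ^ n₀)⁻¹ := by
      rw [pow_succ, mul_inv]; ring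
    have hdb' : dist t (dyad M b) ≤ ((2 : ℝ) ^ M)⁻¹ := by rw [dist_comm]; exact hdb
    calc dist (dyad M a) (dyad M b)
        ≤ dist (dyad M a) s + dist s t + dist t (dyad M b) := dist_triangle4 _ _ _ _
      _ ≤ ((2 : ℝ) ^ M)⁻¹ + dist s t + ((2 : ℝ) ^ M)⁻¹ := by gcongr
      _ < ((2 : ℝ) ^ M)⁻¹ + ((2 : ℝ) ^ (n₀ + 1))⁻¹ + ((2 : ℝ) ^ M)⁻¹ := by gcongr
      _ = 2 * ((2 : ℝ) ^ M)⁻¹ + ((2 : ℝ) ^ (n₀ + 1))⁻¹ := by ring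
      _ ≤ ((2 : ℝ) ^ (n₀ + 1))⁻¹ + ((2 : ℝ) ^ (n₀ + 1))⁻¹ := by gcongr
      _ = ((2 : ℝ) ^ n₀)⁻¹ := hsucc
  -- chaining between the dyadics through the levels `n₀ < m ≤ M`
  set δ : ℕ → ℝ≥0∞ := fun m ↦ if m ≤ M then r ^ m else ⊤ with hδ
  have hδh : ∀ m, n₀ < m → ∀ k, k + 1 ≤ N * 2 ^ m →
      edist (f (dyad m k)) (f (dyad m (k + 1))) ≤ δ m := by
    intro m hm k hk
    by_cases hmM : m ≤ M
    · simp only [hδ, if_pos hmM]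
      exact h m hm hmM k hk
    · simp only [hδ, if_neg hmM]
      exact le_top
  have hchain : ∀ a' b' : ℕ, a' ≤ b' → dyad M b' ≤ N →
      dist (dyad M a') (dyad M b') < ((2 : ℝ) ^ n₀)⁻¹ →
      edist (f (dyad M a')) (f (dyad M b')) ≤ 2 * ∑ i ∈ Finset.range (M - n₀), r ^ (n₀ + 1 + i) := by
    intro a' b' hab' hb'N hd'
    rw [dyad_le_natCast_iff] at hb'N
    have hba : b' - a' < 2 ^ (M - n₀) := by
      rw [dist_dyad, abs_sub_comm, abs_of_nonneg (by simpa using hab'), div_lt_iff₀ (by positivity),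
        ← one_div, div_mul_eq_mul_div, one_mul, lt_div_iff₀ (by positivity)] at hd'
      have : ((b' - a' : ℕ) : ℝ) < 2 ^ (M - n₀) := by
        rw [Nat.cast_sub hab', lt_iff_not_ge]
        intro hle
        have := (mul_le_mul_of_nonneg_right hle (by positivity : (0 : ℝ) ≤ 2 ^ n₀)).trans_lt hd'
        rw [← pow_add, Nat.sub_add_cancel (by omega)] at this
        exact lt_irrefl _ this
      exact_mod_cast this
    have hc := chain (f := f) (δ := δ) (N := N) (n := n₀) hδh M (by omega) a' b' hab' hb'N hba
    refine hc.trans (le_of_eq ?_)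
    congr 1
    refine Finset.sum_congr rfl fun i hi ↦ ?_
    rw [Finset.mem_range] at hi
    simp only [hδ, if_pos (show n₀ + 1 + i ≤ M by omega)]
  have h3 : edist (f (dyad M a)) (f (dyad M b)) ≤
      2 * ∑ i ∈ Finset.range (M - n₀), r ^ (n₀ + 1 + i) := by
    rcases le_total a b with hle | hle
    · exact hchain a b hle hbN hab
    · rw [edist_comm]
      rw [dist_comm] at hab
      exact hchain b a hle haN hab
  calc edist (f s) (f t)
      ≤ edist (f s) (f (dyad M a)) + edist (f (dyad M a)) (f (dyad M b)) +
          edist (f (dyad M b)) (f t) := edist_triangle4 _ _ _ _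
    _ ≤ ϑ + 2 * ∑ i ∈ Finset.range (M - n₀), r ^ (n₀ + 1 + i) + ϑ := by gcongr
    _ = 2 * ϑ + 2 * ∑ i ∈ Finset.range (M - n₀), r ^ (n₀ + 1 + i) := by ring

end Deterministic

/-! ### The finite union bound -/

section UnionBound

variable [PseudoEMetricSpace E] {Ω : Type*} [MeasurableSpace Ω]

/-- **Union bound over the levels `n₀ < m ≤ M`.** For a process `X` whose paths almost surely
have the floor modulus `ϑ` at scale `2^{-M}` on `[0, N]`, the probability that some pair
`s, t ≤ N` with `dist s t < 2^{-(n₀+1)}` has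
`edist (X s) (X t) > 2ϑ + 2 ∑_{i < M - n₀} r^{n₀+1+i}` is at most `∑_{i < M - n₀} N 2^{n₀+1+i} bnd_{n₀+1+i}`,
`bnd_m` bounding the probability of a single level-`m` increment `> r^m` (contrapositive of
`edist_le_of_increments_le_of_floor`; outer measure, no measurability or continuity).
[cite: Legall2016, Lemma 2.10] -/
theorem measure_badModulus_le_sum (P : Measure Ω) {X : ℝ≥0 → Ω → E} {r ϑ : ℝ≥0∞} {N n₀ M : ℕ}
    (hM : n₀ + 2 ≤ M) {bnd : ℕ → ℝ≥0∞}
    (hbnd : ∀ m, n₀ < m → m ≤ M → ∀ k, k + 1 ≤ N * 2 ^ m →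
      P {ω | r ^ m < edist (X (dyad m k) ω) (X (dyad m (k + 1)) ω)} ≤ bnd m)
    (hfloor : ∀ᵐ ω ∂P, ∀ s t : ℝ≥0, s ≤ N → t ≤ N → dist s t ≤ ((2 : ℝ) ^ M)⁻¹ →
      edist (X s ω) (X t ω) ≤ ϑ) :
    P {ω | ∃ s t : ℝ≥0, s ≤ N ∧ t ≤ N ∧ dist s t < ((2 : ℝ) ^ (n₀ + 1))⁻¹ ∧
        2 * ϑ + 2 * ∑ i ∈ Finset.range (M - n₀), r ^ (n₀ + 1 + i) < edist (X s ω) (X t ω)} ≤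
      ∑ i ∈ Finset.range (M - n₀), ((N * 2 ^ (n₀ + 1 + i) : ℕ) : ℝ≥0∞) * bnd (n₀ + 1 + i) := by
  -- the bad increment events at the levels `n₀ < m ≤ M`
  set A : ℕ → Set Ω := fun i ↦ ⋃ k ∈ Finset.range (N * 2 ^ (n₀ + 1 + i)),
    {ω | r ^ (n₀ + 1 + i) < edist (X (dyad (n₀ + 1 + i) k) ω) (X (dyad (n₀ + 1 + i) (k + 1)) ω)}
    with hA
  set G : Set Ω := {ω | ∀ s t : ℝ≥0, s ≤ N → t ≤ N → dist s t ≤ ((2 : ℝ) ^ M)⁻¹ →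
    edist (X s ω) (X t ω) ≤ ϑ} with hG
  have hsub : {ω | ∃ s t : ℝ≥0, s ≤ N ∧ t ≤ N ∧ dist s t < ((2 : ℝ) ^ (n₀ + 1))⁻¹ ∧
      2 * ϑ + 2 * ∑ i ∈ Finset.range (M - n₀), r ^ (n₀ + 1 + i) < edist (X s ω) (X t ω)} ⊆
      (⋃ i ∈ Finset.range (M - n₀), A i) ∪ Gᶜ := by
    rintro ω ⟨s, t, hs, ht, hd, hlt⟩
    by_contra hω
    simp only [Set.mem_union, Set.mem_iUnion, Set.mem_compl_iff, not_or, not_exists, not_not,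
      exists_prop, not_and] at hω
    obtain ⟨hgood, hGω⟩ := hω
    refine absurd hlt (not_lt.2 (edist_le_of_increments_le_of_floor hM (fun m hm hmM k hk ↦ ?_)
      hGω hs ht hd))
    rw [← not_lt]
    intro hlt'
    obtain ⟨i, rfl⟩ : ∃ i, m = n₀ + 1 + i := ⟨m - (n₀ + 1), by omega⟩
    refine hgood i (Finset.mem_range.2 (by omega)) ?_
    simp only [hA, Set.mem_iUnion, Finset.mem_range, Set.mem_setOf_eq, exists_prop]
    exact ⟨k, by omega, hlt'⟩
  have hG0 : P Gᶜ = 0 := by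
    rw [ae_iff] at hfloor
    exact hfloor
  have hAi : ∀ i ∈ Finset.range (M - n₀),
      P (A i) ≤ ((N * 2 ^ (n₀ + 1 + i) : ℕ) : ℝ≥0∞) * bnd (n₀ + 1 + i) := by
    intro i hi
    rw [Finset.mem_range] at hi
    calc P (A i) ≤ ∑ k ∈ Finset.range (N * 2 ^ (n₀ + 1 + i)),
          P {ω | r ^ (n₀ + 1 + i) <
            edist (X (dyad (n₀ + 1 + i) k) ω) (X (dyad (n₀ + 1 + i) (k + 1)) ω)} :=
          measure_biUnion_finset_le _ _
      _ ≤ ∑ _k ∈ Finset.range (N * 2 ^ (n₀ + 1 + i)), bnd (n₀ + 1 + i) :=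
          Finset.sum_le_sum fun k hk ↦ hbnd _ (by omega) (by omega) k
            (by have := Finset.mem_range.1 hk; omega)
      _ = ((N * 2 ^ (n₀ + 1 + i) : ℕ) : ℝ≥0∞) * bnd (n₀ + 1 + i) := by
          rw [Finset.sum_const, Finset.card_range, nsmul_eq_mul]
  calc P _ ≤ P ((⋃ i ∈ Finset.range (M - n₀), A i) ∪ Gᶜ) := measure_mono hsub
    _ ≤ P (⋃ i ∈ Finset.range (M - n₀), A i) + P Gᶜ := measure_union_le _ _
    _ = P (⋃ i ∈ Finset.range (M - n₀), A i) := by rw [hG0, add_zero]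
    _ ≤ ∑ i ∈ Finset.range (M - n₀), P (A i) := measure_biUnion_finset_le _ _
    _ ≤ ∑ i ∈ Finset.range (M - n₀), ((N * 2 ^ (n₀ + 1 + i) : ℕ) : ℝ≥0∞) * bnd (n₀ + 1 + i) :=
        Finset.sum_le_sum hAi

end UnionBound

end KolmogorovChentsov

/-! ### Sub-exponential tails above the floor scale -/

section SubExp

variable [PseudoMetricSpace E] {Ω : Type*} [MeasurableSpace Ω]

/-- **Sub-exponential increment tails on the scales `[2^{-M}, 1]` and a floor modulus below
`2^{-M}` control the modulus of continuity in probability.** Let `0 < α`, `n₀ + 2 ≤ M`, and let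
the level `n₀` be beyond the threshold of `eventually_two_pow_mul_exp_le'`
(`2^m K e^{-c r^m} ≤ 2^{-m}` for `m > n₀`, `r = 2^{1/2-α}`). If `X : ℝ≥0 → Ω → E` has, almost
surely, `d(X_s, X_t) ≤ ϑ` for `s, t ≤ N` with `|s - t| ≤ 2^{-M}`, and the two-point tails
`P{λ ≤ d(X_s, X_t)} ≤ K exp(-c λ / √(t - s))` for `s < t ≤ N` with `2^{-M} ≤ t - s ≤ 1` and
`λ > 0`, then
`P{∃ s, t ≤ N, |s - t| < 2^{-(n₀+1)}, d(X_s, X_t) > 2ϑ + 2 (1 - 2^{-α})⁻¹ 2^{-α(n₀+1)}} ≤ N 2^{-n₀}`.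
(Kemppainen–Smirnov's Prop. 3.8 (2) for lattice curves: Condition G2, hence the tail bound, is
used above the mesh scale only.) [cite: KemppainenSmirnov2017, Prop. 3.8 (2) and §4.1.6] -/
theorem measure_badModulus_le_of_subexp_tails_floor {α : ℝ≥0} (hα0 : 0 < α) {K c : ℝ}
    {N n₀ M : ℕ} (hM : n₀ + 2 ≤ M)
    (hn₀ : ∀ m, n₀ < m →
      (2 : ℝ) ^ m * (K * Real.exp (-(c * (Real.sqrt 2 * (2 : ℝ) ^ (-(α : ℝ))) ^ m))) ≤
        ((2 : ℝ) ^ m)⁻¹)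
    (P : Measure Ω) {X : ℝ≥0 → Ω → E} {ϑ : ℝ≥0}
    (hfloor : ∀ᵐ ω ∂P, ∀ s t : ℝ≥0, s ≤ N → t ≤ N → dist s t ≤ ((2 : ℝ) ^ M)⁻¹ →
      dist (X s ω) (X t ω) ≤ ϑ)
    (htail : ∀ s t : ℝ≥0, s < t → (t : ℝ) ≤ N → ((2 : ℝ) ^ M)⁻¹ ≤ (t : ℝ) - s →
      (t : ℝ) - s ≤ 1 → ∀ l : ℝ, 0 < l →
      P {ω | l ≤ dist (X s ω) (X t ω)} ≤
        ENNReal.ofReal (K * Real.exp (-(c * l / Real.sqrt ((t : ℝ) - s))))) :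
    P {ω | ∃ s t : ℝ≥0, s ≤ N ∧ t ≤ N ∧ dist s t < ((2 : ℝ) ^ (n₀ + 1))⁻¹ ∧
        2 * (ϑ : ℝ≥0∞) + 2 * (1 - (2 : ℝ≥0∞) ^ (-(α : ℝ)))⁻¹ * ((2 : ℝ≥0∞) ^ (-(α : ℝ))) ^ (n₀ + 1) <
          edist (X s ω) (X t ω)} ≤
      (N : ℝ≥0∞) * (2 : ℝ≥0∞)⁻¹ ^ n₀ := by
  have hα0' : 0 < (α : ℝ) := NNReal.coe_pos.2 hα0
  set r : ℝ≥0∞ := (2 : ℝ≥0∞) ^ (-(α : ℝ)) with hr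
  have hr1 : r < 1 := KolmogorovChentsov.two_rpow_neg_lt_one' hα0'
  -- single-increment bound at the levels `n₀ < m ≤ M`
  set pm : ℕ → ℝ≥0∞ :=
    fun m ↦ ENNReal.ofReal (K * Real.exp (-(c * (Real.sqrt 2 * (2 : ℝ) ^ (-(α : ℝ))) ^ m)))
    with hpm
  have hp : ∀ m, n₀ < m → m ≤ M → ∀ k, k + 1 ≤ N * 2 ^ m →
      P {ω | r ^ m < edist (X (dyad m k) ω) (X (dyad m (k + 1)) ω)} ≤ pm m := by
    intro m hm hmM k hk
    have hst : dyad m k < dyad m (k + 1) := by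
      rw [← NNReal.coe_lt_coe, coe_dyad, coe_dyad]
      gcongr
      linarith
    have htN : ((dyad m (k + 1) : ℝ≥0) : ℝ) ≤ N := by
      rw [coe_dyad, div_le_iff₀ (by positivity)]
      exact_mod_cast hk
    have hdiff : ((dyad m (k + 1) : ℝ≥0) : ℝ) - dyad m k = ((2 : ℝ) ^ m)⁻¹ := by
      rw [coe_dyad, coe_dyad]
      push_cast
      ring
    have hle1 : ((dyad m (k + 1) : ℝ≥0) : ℝ) - dyad m k ≤ 1 := by
      rw [hdiff, inv_le_one_iff₀]
      exact Or.inr (one_le_pow₀ one_le_two)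
    have hgeM : ((2 : ℝ) ^ M)⁻¹ ≤ ((dyad m (k + 1) : ℝ≥0) : ℝ) - dyad m k := by
      rw [hdiff, inv_le_inv₀ (by positivity) (by positivity)]
      exact pow_le_pow_right₀ one_le_two hmM
    have hl : 0 < ((2 : ℝ) ^ (-(α : ℝ))) ^ m := by positivity
    have hmono : {ω | r ^ m < edist (X (dyad m k) ω) (X (dyad m (k + 1)) ω)} ⊆
        {ω | ((2 : ℝ) ^ (-(α : ℝ))) ^ m ≤ dist (X (dyad m k) ω) (X (dyad m (k + 1)) ω)} := by
      intro ω hω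
      simp only [Set.mem_setOf_eq, hr, KolmogorovChentsov.two_rpow_neg_pow_eq_ofReal,
        edist_dist] at hω ⊢
      exact ((ENNReal.ofReal_lt_ofReal_iff_of_nonneg hl.le).1 hω).le
    calc P _ ≤ P {ω | ((2 : ℝ) ^ (-(α : ℝ))) ^ m ≤ dist (X (dyad m k) ω) (X (dyad m (k + 1)) ω)} :=
          measure_mono hmono
      _ ≤ ENNReal.ofReal (K * Real.exp (-(c * ((2 : ℝ) ^ (-(α : ℝ))) ^ m /
            Real.sqrt (((dyad m (k + 1) : ℝ≥0) : ℝ) - dyad m k)))) :=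
          htail _ _ hst htN hgeM hle1 _ hl
      _ = pm m := by rw [hpm, hdiff, mul_div_assoc, KolmogorovChentsov.threshold_div_sqrt]
  -- the floor hypothesis in `ℝ≥0∞`
  have hfloor' : ∀ᵐ ω ∂P, ∀ s t : ℝ≥0, s ≤ N → t ≤ N → dist s t ≤ ((2 : ℝ) ^ M)⁻¹ →
      edist (X s ω) (X t ω) ≤ (ϑ : ℝ≥0∞) := by
    filter_upwards [hfloor] with ω hω s t hs ht hd
    rw [edist_dist, ← ENNReal.ofReal_coe_nnreal]
    exact ENNReal.ofReal_le_ofReal (hω s t hs ht hd)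
  have hmain := KolmogorovChentsov.measure_badModulus_le_sum P hM hp hfloor'
  -- enlarge the threshold: the finite geometric sum is below the full one
  have hsum : 2 * ∑ i ∈ Finset.range (M - n₀), r ^ (n₀ + 1 + i) ≤
      2 * (1 - r)⁻¹ * r ^ (n₀ + 1) := by
    rw [mul_assoc]
    gcongr
    calc ∑ i ∈ Finset.range (M - n₀), r ^ (n₀ + 1 + i)
        ≤ ∑' i, r ^ (n₀ + 1 + i) := ENNReal.sum_le_tsum _
      _ = (1 - r)⁻¹ * r ^ (n₀ + 1) := by
          simp_rw [pow_add _ (n₀ + 1)]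
          rw [ENNReal.tsum_mul_left, ENNReal.tsum_geometric, mul_comm]
  refine le_trans (measure_mono ?_) (hmain.trans ?_)
  · rintro ω ⟨s, t, hs, ht, hd, hlt⟩
    exact ⟨s, t, hs, ht, hd, lt_of_le_of_lt (add_le_add le_rfl hsum) hlt⟩
  -- the terms are `≤ N (2⁻¹)^m`
  have hterm : ∀ i ∈ Finset.range (M - n₀),
      ((N * 2 ^ (n₀ + 1 + i) : ℕ) : ℝ≥0∞) * pm (n₀ + 1 + i) ≤
        (N : ℝ≥0∞) * ((2 : ℝ≥0∞)⁻¹ ^ (n₀ + 1) * (2 : ℝ≥0∞)⁻¹ ^ i) := by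
    intro i _
    have hm := hn₀ (n₀ + 1 + i) (by omega)
    have h2 : ((N * 2 ^ (n₀ + 1 + i) : ℕ) : ℝ≥0∞) * pm (n₀ + 1 + i) =
        (N : ℝ≥0∞) * ENNReal.ofReal ((2 : ℝ) ^ (n₀ + 1 + i) *
          (K * Real.exp (-(c * (Real.sqrt 2 * (2 : ℝ) ^ (-(α : ℝ))) ^ (n₀ + 1 + i))))) := by
      rw [ENNReal.ofReal_mul (by positivity), ENNReal.ofReal_pow zero_le_two (n₀ + 1 + i),
        ENNReal.ofReal_ofNat]
      simp only [hpm]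
      push_cast
      ring
    rw [h2, ← pow_add]
    gcongr
    calc ENNReal.ofReal ((2 : ℝ) ^ (n₀ + 1 + i) *
          (K * Real.exp (-(c * (Real.sqrt 2 * (2 : ℝ) ^ (-(α : ℝ))) ^ (n₀ + 1 + i)))))
        ≤ ENNReal.ofReal (((2 : ℝ) ^ (n₀ + 1 + i))⁻¹) := ENNReal.ofReal_le_ofReal hm
      _ = (2 : ℝ≥0∞)⁻¹ ^ (n₀ + 1 + i) := by
          rw [ENNReal.ofReal_inv_of_pos (by positivity), ENNReal.ofReal_pow zero_le_two,
            ENNReal.ofReal_ofNat, ENNReal.inv_pow]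
  calc ∑ i ∈ Finset.range (M - n₀), ((N * 2 ^ (n₀ + 1 + i) : ℕ) : ℝ≥0∞) * pm (n₀ + 1 + i)
      ≤ ∑ i ∈ Finset.range (M - n₀), (N : ℝ≥0∞) * ((2 : ℝ≥0∞)⁻¹ ^ (n₀ + 1) * (2 : ℝ≥0∞)⁻¹ ^ i) :=
        Finset.sum_le_sum hterm
    _ ≤ ∑' i, (N : ℝ≥0∞) * ((2 : ℝ≥0∞)⁻¹ ^ (n₀ + 1) * (2 : ℝ≥0∞)⁻¹ ^ i) := ENNReal.sum_le_tsum _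
    _ = (N : ℝ≥0∞) * (2 : ℝ≥0∞)⁻¹ ^ n₀ := by
        rw [ENNReal.tsum_mul_left, ENNReal.tsum_mul_left, ENNReal.tsum_geometric,
          ENNReal.one_sub_inv_two, inv_inv, pow_succ, mul_assoc ((2 : ℝ≥0∞)⁻¹ ^ n₀),
          ENNReal.inv_mul_cancel (by norm_num) (by norm_num), mul_one]

/-- **Billingsley's condition (ii), eventually, from tails above the floor (uniform in the
process).** For `0 < α < 1/2`, constants `K`, `c > 0`, a horizon `N`, a target oscillation
`η > 0` and `ε > 0` there is ONE level `n₀` such that: for every floor level `M ≥ n₀ + 2` and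
every process `X` (any space, any measure `P`) whose paths almost surely move by at most `η/4`
over distances `≤ 2^{-M}` in `[0, N]` and whose two-point increment tails hold on the scales
`[2^{-M}, 1]`, `P{∃ s, t ≤ N, |s - t| < 2^{-(n₀+1)}, η ≤ d(X_s, X_t)} ≤ ε`. For a lattice family
(driving processes `W^k` of the interfaces at mesh `δ_k → 0`: tails above the mesh scale from
Condition G2 via KS Prop. 3.7 and eq. (10), deterministic floor modulus `ϑ_k → 0` at the mesh
scale `2^{-M_k} → 0`) the hypotheses hold for all `k ≥ k₀(η)`, which is condition (ii) of
Billingsley's Thm. 7.3 "for `n ≥ n₀`"; the finitely many coarse meshes are absorbed by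
`Process.exists_forall_measure_badModulusSet_le_of_eventually`.
[cite: KemppainenSmirnov2017, Thm. 3.9 and §4.1.6] -/
theorem exists_level_of_subexp_tails_floor {α : ℝ≥0} (hα0 : 0 < α) (hα : (α : ℝ) < 1 / 2)
    (K : ℝ) {c : ℝ} (hc : 0 < c) (N : ℕ) {η : ℝ} (hη : 0 < η) {ε : ℝ≥0∞} (hε : 0 < ε) :
    ∃ n₀ : ℕ, ∀ (M : ℕ), n₀ + 2 ≤ M →
      ∀ {Ω : Type u} {mΩ : MeasurableSpace Ω} (P : Measure Ω) (X : ℝ≥0 → Ω → E) (ϑ : ℝ≥0),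
        4 * (ϑ : ℝ) ≤ η →
        (∀ᵐ ω ∂P, ∀ s t : ℝ≥0, s ≤ N → t ≤ N → dist s t ≤ ((2 : ℝ) ^ M)⁻¹ →
          dist (X s ω) (X t ω) ≤ ϑ) →
        (∀ s t : ℝ≥0, s < t → (t : ℝ) ≤ N → ((2 : ℝ) ^ M)⁻¹ ≤ (t : ℝ) - s →
          (t : ℝ) - s ≤ 1 → ∀ l : ℝ, 0 < l →
          P {ω | l ≤ dist (X s ω) (X t ω)} ≤
            ENNReal.ofReal (K * Real.exp (-(c * l / Real.sqrt ((t : ℝ) - s))))) →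
        P {ω | ∃ s t : ℝ≥0, s ≤ N ∧ t ≤ N ∧ dist s t < ((2 : ℝ) ^ (n₀ + 1))⁻¹ ∧
          η ≤ dist (X s ω) (X t ω)} ≤ ε := by
  have hα0' : 0 < (α : ℝ) := NNReal.coe_pos.2 hα0
  set r : ℝ≥0∞ := (2 : ℝ≥0∞) ^ (-(α : ℝ)) with hr
  have hr1 : r < 1 := KolmogorovChentsov.two_rpow_neg_lt_one' hα0'
  -- (1) the level threshold of the tails
  have hev1 : ∀ᶠ n₀ : ℕ in atTop, ∀ m, n₀ < m →
      (2 : ℝ) ^ m * (K * Real.exp (-(c * (Real.sqrt 2 * (2 : ℝ) ^ (-(α : ℝ))) ^ m))) ≤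
        ((2 : ℝ) ^ m)⁻¹ := by
    obtain ⟨n₁, hn₁⟩ := eventually_atTop.1 (KolmogorovChentsov.eventually_two_pow_mul_exp_le'
      (KolmogorovChentsov.one_lt_sqrt_two_mul_two_rpow_neg hα) K hc)
    exact eventually_atTop.2 ⟨n₁, fun n₀ hn₀ m hm ↦ hn₁ m (by omega)⟩
  -- (2) `N 2^{-n₀} < ε`
  have hev2 : ∀ᶠ n₀ : ℕ in atTop, (N : ℝ≥0∞) * (2 : ℝ≥0∞)⁻¹ ^ n₀ < ε := by
    have h1 : Tendsto (fun n₀ : ℕ ↦ (2 : ℝ≥0∞)⁻¹ ^ n₀) atTop (𝓝 0) :=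
      ENNReal.tendsto_pow_atTop_nhds_zero_iff.2 (ENNReal.inv_lt_one.2 ENNReal.one_lt_two)
    have h2 := ENNReal.Tendsto.const_mul h1 (a := (N : ℝ≥0∞)) (Or.inr (ENNReal.natCast_ne_top N))
    rw [mul_zero] at h2
    exact h2.eventually_lt_const hε
  -- (3) the chaining tail `2 (1 - r)⁻¹ r^{n₀+1} < η/2`
  have hev3 : ∀ᶠ n₀ : ℕ in atTop, 2 * (1 - r)⁻¹ * r ^ (n₀ + 1) < ENNReal.ofReal (η / 2) := by
    have h1 : Tendsto (fun n₀ : ℕ ↦ r ^ (n₀ + 1)) atTop (𝓝 0) :=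
      (ENNReal.tendsto_pow_atTop_nhds_zero_iff.2 hr1).comp (tendsto_add_atTop_nat 1)
    have h2 := ENNReal.Tendsto.const_mul h1 (a := 2 * (1 - r)⁻¹)
      (Or.inr (ENNReal.mul_ne_top (by simp) (ENNReal.inv_ne_top.2 (tsub_pos_of_lt hr1).ne')))
    rw [mul_zero] at h2
    exact h2.eventually_lt_const (ENNReal.ofReal_pos.2 (half_pos hη))
  obtain ⟨n₀, h1, h2, h3⟩ := (hev1.and (hev2.and hev3)).exists
  refine ⟨n₀, fun M hM ↦ ?_⟩
  intro Ω mΩ P X ϑ hϑ hfloor htail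
  have hmain := measure_badModulus_le_of_subexp_tails_floor hα0 hM h1 P hfloor htail
  refine le_trans (measure_mono ?_) (hmain.trans h2.le)
  -- `η ≤ dist` forces the threshold: `2ϑ + tail < η`
  rintro ω ⟨s, t, hs, ht, hd, hle⟩
  refine ⟨s, t, hs, ht, hd, ?_⟩
  have hthr : 2 * (ϑ : ℝ≥0∞) + 2 * (1 - r)⁻¹ * r ^ (n₀ + 1) < ENNReal.ofReal η := by
    have hϑ' : 2 * (ϑ : ℝ≥0∞) ≤ ENNReal.ofReal (η / 2) := by
      rw [← ENNReal.ofReal_coe_nnreal, ← ENNReal.ofReal_ofNat, ← ENNReal.ofReal_mul zero_le_two]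
      exact ENNReal.ofReal_le_ofReal (by linarith)
    calc 2 * (ϑ : ℝ≥0∞) + 2 * (1 - r)⁻¹ * r ^ (n₀ + 1)
        < ENNReal.ofReal (η / 2) + ENNReal.ofReal (η / 2) :=
          ENNReal.add_lt_add_of_le_of_lt (ENNReal.mul_ne_top (by simp) ENNReal.coe_ne_top) hϑ' h3
      _ = ENNReal.ofReal η := by
          rw [← ENNReal.ofReal_add (by linarith) (by linarith), add_halves]
  calc 2 * (ϑ : ℝ≥0∞) + 2 * (1 - r)⁻¹ * r ^ (n₀ + 1) < ENNReal.ofReal η := hthr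
    _ ≤ edist (X s ω) (X t ω) := by
        rw [edist_dist]
        exact ENNReal.ofReal_le_ofReal hle

/-- **Billingsley's condition (ii), eventually, with a floor modulus off a bad event.** As
`exists_level_of_subexp_tails_floor`, but the floor modulus (`d(X_s, X_t) ≤ ϑ` for `s, t ≤ N`,
`|s - t| ≤ 2^{-M}`) is only required OFF a measurable event `B`, and the bound becomes `ε + P B`:
restrict `P` to `Bᶜ` (the tails only improve, the floor becomes almost sure), apply the
almost-sure version, and split the bad set along `B`. This is the form available on the lattice,
where the floor modulus of the driving process comes from a modulus of the curve
(`RandomPlanarGeometry/LoewnerDrivingModulus.lean`), an event of probability close to `1`.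
[cite: KemppainenSmirnov2017, Thm. 3.9 and §4.1.6] -/
theorem exists_level_of_subexp_tails_floor' {α : ℝ≥0} (hα0 : 0 < α) (hα : (α : ℝ) < 1 / 2)
    (K : ℝ) {c : ℝ} (hc : 0 < c) (N : ℕ) {η : ℝ} (hη : 0 < η) {ε : ℝ≥0∞} (hε : 0 < ε) :
    ∃ n₀ : ℕ, ∀ (M : ℕ), n₀ + 2 ≤ M →
      ∀ {Ω : Type u} {mΩ : MeasurableSpace Ω} (P : Measure Ω) (X : ℝ≥0 → Ω → E) (ϑ : ℝ≥0)
        (B : Set Ω), MeasurableSet B → 4 * (ϑ : ℝ) ≤ η →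
        (∀ ω, ω ∉ B → ∀ s t : ℝ≥0, s ≤ N → t ≤ N → dist s t ≤ ((2 : ℝ) ^ M)⁻¹ →
          dist (X s ω) (X t ω) ≤ ϑ) →
        (∀ s t : ℝ≥0, s < t → (t : ℝ) ≤ N → ((2 : ℝ) ^ M)⁻¹ ≤ (t : ℝ) - s →
          (t : ℝ) - s ≤ 1 → ∀ l : ℝ, 0 < l →
          P {ω | l ≤ dist (X s ω) (X t ω)} ≤
            ENNReal.ofReal (K * Real.exp (-(c * l / Real.sqrt ((t : ℝ) - s))))) →
        P {ω | ∃ s t : ℝ≥0, s ≤ N ∧ t ≤ N ∧ dist s t < ((2 : ℝ) ^ (n₀ + 1))⁻¹ ∧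
          η ≤ dist (X s ω) (X t ω)} ≤ ε + P B := by
  obtain ⟨n₀, hn₀⟩ := exists_level_of_subexp_tails_floor (E := E) hα0 hα K hc N hη hε
  refine ⟨n₀, fun M hM ↦ ?_⟩
  intro Ω mΩ P X ϑ B hB hϑ hfloor htail
  set A : Set Ω := {ω | ∃ s t : ℝ≥0, s ≤ N ∧ t ≤ N ∧ dist s t < ((2 : ℝ) ^ (n₀ + 1))⁻¹ ∧
    η ≤ dist (X s ω) (X t ω)} with hA
  -- the almost-sure version under the restricted measure `P|_{Bᶜ}`
  have hfloor' : ∀ᵐ ω ∂P.restrict Bᶜ, ∀ s t : ℝ≥0, s ≤ N → t ≤ N →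
      dist s t ≤ ((2 : ℝ) ^ M)⁻¹ → dist (X s ω) (X t ω) ≤ ϑ :=
    (ae_restrict_iff' hB.compl).2 (Eventually.of_forall fun ω hω ↦ hfloor ω hω)
  have htail' : ∀ s t : ℝ≥0, s < t → (t : ℝ) ≤ N → ((2 : ℝ) ^ M)⁻¹ ≤ (t : ℝ) - s →
      (t : ℝ) - s ≤ 1 → ∀ l : ℝ, 0 < l →
      P.restrict Bᶜ {ω | l ≤ dist (X s ω) (X t ω)} ≤
        ENNReal.ofReal (K * Real.exp (-(c * l / Real.sqrt ((t : ℝ) - s)))) :=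
    fun s t hst htN hge hle l hl ↦
      (Measure.restrict_apply_le _ _).trans (htail s t hst htN hge hle l hl)
  have hres : P.restrict Bᶜ A ≤ ε := hn₀ M hM (P.restrict Bᶜ) X ϑ hϑ hfloor' htail'
  -- split along `B`
  calc P A ≤ P (A ∩ Bᶜ ∪ B) := measure_mono fun ω hω ↦ by
          by_cases hωB : ω ∈ B
          · exact Or.inr hωB
          · exact Or.inl ⟨hω, hωB⟩
    _ ≤ P (A ∩ Bᶜ) + P B := measure_union_le _ _
    _ = P.restrict Bᶜ A + P B := by rw [Measure.restrict_apply' hB.compl]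
    _ ≤ ε + P B := add_le_add hres le_rfl

end SubExp

end Literature.Probability.Process
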